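import Literature.NumberTheory.Automorphic.PlaneLatticesCompanionAffineStrata          -- (P5c) I ★ p851805: `affine_norm_condition_iff` (this seat)
import Literature.NumberTheory.Automorphic.PlaneLatticesCompanionScalarReduction     -- ★ B-p08: Hermite coordinates of `Λ.map A ≤ ϖΛ` (`map_le_map_smul_one_iff`), `upperTriangular_inv_mul_companion_mul`
import HarnessLib

/-!
# When does a companion matrix reduce to the EISENSTEIN CENTRE `a` on a stable Hermite plane lattice?  The `|2| = 1`-free twin of ★ `PlaneLatticesCompanionScalarReduction`

Topic `NumberTheory/Automorphic`; namespace `Literature.NumberTheory.Automorphic`.  THEOREMS ONLY (no definition, no instance, no notation, no named fact,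
no `sorry`).  Cell `pub/hodgecm-mathlib`, LH4 price list (P5c-ii) «COMPANION COUNT WITH THE EISENSTEIN CENTRE» (dealer LH4-plan (g6) WORD #70∕#85∕14:57Z (R1)(R2);
M6 memo B-p08 (g40) §2(e)∕§4).  Seat LH5-p01 (g5).  HONEST LABEL: HC_CM is proved only modulo the printed citations (hLiu418 = stmt-HodgeConjecture-24832, h413 =
stmt-HodgeConjecture-24833) until rung 0 closes; this file is unconditional, elementary and count-neutral.

SETTING = part I (★ `PlaneLatticesCompanionAffineStrata`): `C = !![0, −d; 1, t]`, an integer centre `a` with `(C − a·1)² = f·(C − a·1) + e′·1`, i.e. `t − 2a = f`,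
`a² − ta + d = −e′`, with `|f| ≤ |ϖ^{j+1}|` SHARP and `|e′| = |ϖ^{2j+1}|`.  The INTERIOR condition of ★ B-p08 `(C − (t∕2)·1)·Λ ≤ ϖ·Λ` becomes `(C − a·1)·Λ ≤ ϖ·Λ`
(for the true centre of a dyadic (W-unit) row `t∕2 ∉ 𝒪` while `a ∈ 𝒪`; M6 §2(e): `k̄_x = ā` scalar at an interior fixed vertex); in Hermite coordinates it reads
`1 ≤ 2k + e ∧ k + e ≤ j ∧ ϖ^{−(k+1)}(y′ + a) ∈ 𝒪` (B-p08's `ϖ^{−(k+1)}(2y′ + t) ∈ 𝒪` with `2y′ + t ↦ y′ + a`).  With `a := t∕2`, `f := 0`, `e′ := (t² − 4d)∕4` (when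
`|2| = 1`) this is ★ `companion_scalarReduction_iff_of_hermite` token for token.

* §0 `reduction_invariant` — `(A − a₁·1)·Λ ≤ ϖ·Λ ↔ (A − a·1)·Λ ≤ ϖ·Λ` when `|a₁ − a| ≤ |ϖ|` (the interior condition does not see a re-centring inside `a + 𝔪`).
* §1 `companion_affineReduction_iff_of_hermite` — the interior criterion in Hermite coordinates.

## References
* [Flicker1998UnitaryFL] Y. Z. Flicker, *The unitary fundamental lemma* (1998), §6 p. 97 (interior∕boundary fixed vertices of a type-(2) element).
* [Macdonald1995] I. G. Macdonald, *Symmetric Functions and Hall Polynomials*, 2nd ed. (1995), Ch. V §2 (Hermite normal form of lattices).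
-/

set_option autoImplicit false

noncomputable section

open scoped ValuativeRel Matrix MatrixGroups
open Matrix ValuativeRel Finset IsLocalRing

namespace Literature.NumberTheory.Automorphic

section Criterion

variable {F : Type*} [Field F] [ValuativeRel F] {ϖ : F} (hϖ : IsUniformizingElement ϖ)

/-! ## §0 The interior condition does not see a re-centring inside `a + 𝔪` -/

include hϖ in
/-- **RE-CENTRING INVARIANCE OF THE REDUCTION CONDITION**: if `|a₁ − a| ≤ |ϖ|` then for every `𝒪`-lattice `Λ` and matrix `A`,
`(A − a₁·1)·Λ ≤ ϖ·Λ ↔ (A − a·1)·Λ ≤ ϖ·Λ` — since `(a₁ − a)·v = ϖ·((ϖ⁻¹(a₁ − a))·v) ∈ ϖ·Λ` for `v ∈ Λ`. [cite: Macdonald1995, Ch. V §2] -/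
theorem reduction_invariant (Λ : Submodule 𝒪[F] (Fin 2 → F)) {A : Matrix (Fin 2) (Fin 2) F} {a a₁ : F}
    (h : valuation F (a₁ - a) ≤ valuation F ϖ) :
    Λ.map ((Matrix.toLin' (A - a₁ • (1 : Matrix (Fin 2) (Fin 2) F))).restrictScalars 𝒪[F]) ≤
        Λ.map ((Matrix.toLin' (ϖ • (1 : Matrix (Fin 2) (Fin 2) F))).restrictScalars 𝒪[F]) ↔
      Λ.map ((Matrix.toLin' (A - a • (1 : Matrix (Fin 2) (Fin 2) F))).restrictScalars 𝒪[F]) ≤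
        Λ.map ((Matrix.toLin' (ϖ • (1 : Matrix (Fin 2) (Fin 2) F))).restrictScalars 𝒪[F]) := by
  have h0 := hϖ.ne_zero
  set c : F := ϖ⁻¹ * (a₁ - a) with hc
  have hcO : c ∈ 𝒪[F] := by
    rw [Valuation.mem_integer_iff, hc, map_mul, map_inv₀]
    calc (valuation F ϖ)⁻¹ * valuation F (a₁ - a) ≤ (valuation F ϖ)⁻¹ * valuation F ϖ := mul_le_mul' le_rfl h
      _ = 1 := inv_mul_cancel₀ ((Valuation.ne_zero_iff _).2 h0)
  -- `(a₁ − a)·v ∈ ϖ·Λ` for `v ∈ Λ`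
  have key : ∀ v ∈ Λ, Matrix.toLin' ((a₁ - a) • (1 : Matrix (Fin 2) (Fin 2) F)) v ∈
      Λ.map ((Matrix.toLin' (ϖ • (1 : Matrix (Fin 2) (Fin 2) F))).restrictScalars 𝒪[F]) := by
    intro v hv
    refine ⟨(⟨c, hcO⟩ : 𝒪[F]) • v, Λ.smul_mem _ hv, ?_⟩
    rw [LinearMap.coe_restrictScalars, Matrix.toLin'_apply, Matrix.toLin'_apply, Matrix.smul_mulVec, Matrix.one_mulVec,
      Matrix.smul_mulVec, Matrix.one_mulVec, show ((⟨c, hcO⟩ : 𝒪[F]) • v : Fin 2 → F) = c • v from rfl, smul_smul, hc,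
      mul_inv_cancel_left₀ h0]
  have hdec : A - a₁ • (1 : Matrix (Fin 2) (Fin 2) F) = (A - a • (1 : Matrix (Fin 2) (Fin 2) F)) - (a₁ - a) • (1 : Matrix (Fin 2) (Fin 2) F) := by
    rw [sub_smul]; abel
  have happ : ∀ v : Fin 2 → F, ((Matrix.toLin' (A - a • (1 : Matrix (Fin 2) (Fin 2) F))).restrictScalars 𝒪[F]) v =
      ((Matrix.toLin' (A - a₁ • (1 : Matrix (Fin 2) (Fin 2) F))).restrictScalars 𝒪[F]) v + Matrix.toLin' ((a₁ - a) • (1 : Matrix (Fin 2) (Fin 2) F)) v := by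
    intro v
    rw [LinearMap.coe_restrictScalars, LinearMap.coe_restrictScalars, ← LinearMap.add_apply, ← map_add, hdec, sub_add_cancel]
  rw [Submodule.map_le_iff_le_comap, Submodule.map_le_iff_le_comap]
  constructor
  · intro hle v hv
    have h1 := hle hv
    rw [Submodule.mem_comap] at h1 ⊢
    rw [happ]
    exact Submodule.add_mem _ h1 (key v hv)
  · intro hle v hv
    have h1 := hle hv
    rw [Submodule.mem_comap] at h1 ⊢
    rw [happ] at h1
    have := Submodule.sub_mem _ h1 (key v hv)
    rwa [add_sub_cancel_right] at this

/-! ## §1 The interior criterion in Hermite coordinates -/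

variable [IsDiscreteValuationRing 𝒪[F]]

include hϖ in
/-- **AFFINE (EISENSTEIN-CENTRE) REDUCTION IN HERMITE COORDINATES** — ★ `companion_scalarReduction_iff_of_hermite` with the centre `t∕2` replaced by the integer `a` of
an affine datum (`t − 2a = f`, `a² − ta + d = −e′`, `|f| ≤ |ϖ^{j+1}|`, `|e′| = |ϖ^{2j+1}|`; no `|2| = 1`): for `↑g = T(k, y, −k−e)`, `Λ(g)` `C`-stable, `y′ := ϖ^{k+e}y`,
`(C − a·1)·Λ(g) ≤ ϖ·Λ(g)` — `C` REDUCES TO THE SCALAR `a` on `Λ(g)∕ϖΛ(g)` — iff `1 ≤ 2k + e ∧ k + e ≤ j ∧ ϖ^{−(k+1)}(y′ + a) ∈ 𝒪`.  The matrix of `C − a` on `Λ(g)` is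
`!![−y′ − a, −M; ϖ^{2k+e}, y′ + t − a]`, `M = ϖ^{−(2k+e)}(y′² + ty′ + d)`, `y′ + t − a = (y′ + a) + f` with `ϖ⁻¹f ∈ 𝒪`; the corner is part I's `affine_norm_condition_iff` at the
exponent `2k + e + 1`. [cite: Flicker1998UnitaryFL, §6 p. 97] [cite: Macdonald1995, Ch. V §2] -/
theorem companion_affineReduction_iff_of_hermite {t d a f e' : F} (haO : a ∈ 𝒪[F]) {j : ℕ}
    (hf : valuation F f ≤ valuation F (ϖ ^ (j + 1))) (hj : valuation F e' = valuation F (ϖ ^ (2 * j + 1)))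
    (htf : t - 2 * a = f) (hde : a * a - t * a + d = -e') (hd : valuation F d = 1) {e : ℕ} (he : e ≤ 1) (γ : GL (Fin 2) F)
    (hγ : (γ : Matrix (Fin 2) (Fin 2) F) = !![0, -d; 1, t]) {k : ℕ} {y : F} (g : GL (Fin 2) F)
    (hg : (g : Matrix (Fin 2) (Fin 2) F) = !![ϖ ^ (k : ℤ), y; 0, ϖ ^ (-(k : ℤ) - e)])
    (hst : (Submodule.span 𝒪[F] (Set.range ((g : Matrix (Fin 2) (Fin 2) F))ᵀ)).map
        ((Matrix.toLin' (γ : Matrix (Fin 2) (Fin 2) F)).restrictScalars 𝒪[F]) = Submodule.span 𝒪[F] (Set.range ((g : Matrix (Fin 2) (Fin 2) F))ᵀ)) :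
    (Submodule.span 𝒪[F] (Set.range ((g : Matrix (Fin 2) (Fin 2) F))ᵀ)).map
          ((Matrix.toLin' ((γ : Matrix (Fin 2) (Fin 2) F) - a • (1 : Matrix (Fin 2) (Fin 2) F))).restrictScalars 𝒪[F]) ≤
        (Submodule.span 𝒪[F] (Set.range ((g : Matrix (Fin 2) (Fin 2) F))ᵀ)).map
          ((Matrix.toLin' (ϖ • (1 : Matrix (Fin 2) (Fin 2) F))).restrictScalars 𝒪[F]) ↔
      1 ≤ 2 * k + e ∧ k + e ≤ j ∧ ϖ ^ (-((k + 1 : ℕ) : ℤ)) * (ϖ ^ (-(-(k : ℤ) - e)) * y + a) ∈ 𝒪[F] := by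
  have h0 := hϖ.ne_zero
  have hfO : f ∈ 𝒪[F] := (Valuation.mem_integer_iff _ _).2 (hf.trans ((Valuation.mem_integer_iff _ _).1 ((𝒪[F]).pow_mem hϖ.mem _)))
  have ht : t ∈ 𝒪[F] := by
    rw [show t = a + a + f by linear_combination htf]; exact (𝒪[F]).add_mem ((𝒪[F]).add_mem haO haO) hfO
  -- `ϖ⁻¹ f ∈ 𝒪` (`|f| ≤ |ϖ^{j+1}| ≤ |ϖ|`)
  have hfϖ : ϖ⁻¹ * f ∈ 𝒪[F] := by
    rw [Valuation.mem_integer_iff, map_mul, map_inv₀]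
    have h1 : valuation F f ≤ valuation F ϖ * valuation F (ϖ ^ j) := by rw [← map_mul, ← pow_succ']; exact hf
    calc (valuation F ϖ)⁻¹ * valuation F f ≤ (valuation F ϖ)⁻¹ * (valuation F ϖ * valuation F (ϖ ^ j)) := mul_le_mul' le_rfl h1
      _ = valuation F (ϖ ^ j) := inv_mul_cancel_left₀ ((Valuation.ne_zero_iff _).2 h0) _
      _ ≤ 1 := (Valuation.mem_integer_iff _ _).1 ((𝒪[F]).pow_mem hϖ.mem _)
  -- unpack stability
  obtain ⟨-, hyO, hnorm⟩ := (map_companion_span_eq_self_iff_of_hermite hϖ γ g hγ hd ht hg).1 hst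
  rw [(companion_rescale_identities h0 (k := k) (e := e) rfl y t d (0 : F) (0 : F) (0 : F)).1] at hnorm
  obtain ⟨hkN, hz⟩ := (affine_norm_condition_iff hϖ hf hj htf hde he _).1 hnorm
  set y' : F := ϖ ^ (-(-(k : ℤ) - e)) * y with hy'
  -- the matrix `g⁻¹ (γ − c) g = m − c·1`
  rw [map_le_map_smul_one_iff g _ h0]
  have hm : ((g⁻¹ : GL (Fin 2) F) : Matrix (Fin 2) (Fin 2) F) * ((γ : Matrix (Fin 2) (Fin 2) F) - a • (1 : Matrix (Fin 2) (Fin 2) F)) *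
        (g : Matrix (Fin 2) (Fin 2) F) =
      !![-y' - a, -(ϖ ^ (-((2 * k + e : ℕ) : ℤ)) * (y' ^ 2 + t * y' + d)); ϖ ^ (((2 * k + e : ℕ) : ℤ)), y' + t - a] := by
    have hconj : ((g⁻¹ : GL (Fin 2) F) : Matrix (Fin 2) (Fin 2) F) * (γ : Matrix (Fin 2) (Fin 2) F) * (g : Matrix (Fin 2) (Fin 2) F) =
        !![-(y * (ϖ ^ (-(k : ℤ) - e))⁻¹), -((ϖ ^ (k : ℤ))⁻¹ * (ϖ ^ (-(k : ℤ) - e))⁻¹ * (y ^ 2 + t * y * ϖ ^ (-(k : ℤ) - e) + d * (ϖ ^ (-(k : ℤ) - e)) ^ 2));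
           ϖ ^ (k : ℤ) * (ϖ ^ (-(k : ℤ) - e))⁻¹, y * (ϖ ^ (-(k : ℤ) - e))⁻¹ + t] := by
      rw [Matrix.coe_units_inv, hg, hγ, upperTriangular_inv_mul_companion_mul (zpow_ne_zero _ h0) (zpow_ne_zero _ h0)]
    have e1 : y * (ϖ ^ (-(k : ℤ) - e))⁻¹ = y' := by rw [hy', ← _root_.zpow_neg, mul_comm]
    have e2 : ϖ ^ (k : ℤ) * (ϖ ^ (-(k : ℤ) - e))⁻¹ = ϖ ^ (((2 * k + e : ℕ) : ℤ)) := by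
      rw [← _root_.zpow_neg, ← zpow_add₀ h0]; congr 1; push_cast; ring
    have e3 : (ϖ ^ (k : ℤ))⁻¹ * (ϖ ^ (-(k : ℤ) - e))⁻¹ * (y ^ 2 + t * y * ϖ ^ (-(k : ℤ) - e) + d * (ϖ ^ (-(k : ℤ) - e)) ^ 2) =
        ϖ ^ (-((2 * k + e : ℕ) : ℤ)) * (y' ^ 2 + t * y' + d) := by
      have : (ϖ ^ (-(k : ℤ) - e)) ^ 2 = ϖ ^ (2 * (-(k : ℤ) - e)) := by rw [← zpow_natCast, ← _root_.zpow_mul, mul_comm]; norm_num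
      rw [this, ← (companion_rescale_identities h0 (k := k) (e := e) rfl y t d (0 : F) (0 : F) (0 : F)).1, ← _root_.zpow_neg, ← _root_.zpow_neg,
        ← zpow_add₀ h0]
      congr 1; ring
    rw [Matrix.mul_sub, Matrix.sub_mul, hconj, e1, e2, e3, Matrix.mul_smul, Matrix.mul_one, Matrix.smul_mul, ← Units.val_mul, inv_mul_cancel,
      Units.val_one]
    ext i j
    fin_cases i <;> fin_cases j <;> simp [Matrix.smul_apply]
  rw [hm]
  -- `ϖ⁻¹(y′ + a) ∈ 𝒪` and `ϖ^{-(k+1)}(y′ + a) ∈ 𝒪`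
  have hpow : ∀ (a : ℤ) (w : F), ϖ ^ a * w ∈ 𝒪[F] → ∀ b : ℤ, a ≤ b → ϖ ^ b * w ∈ 𝒪[F] := fun a w hw b hab => by
    have : ϖ ^ b * w = ϖ ^ (b - a) * (ϖ ^ a * w) := by rw [← mul_assoc, ← zpow_add₀ h0, sub_add_cancel]
    rw [this]
    exact (𝒪[F]).mul_mem ((zpow_uniformizer_mem_integer_iff hϖ _).2 (by omega)) hw
  -- the four entries of `ϖ⁻¹ • (m − c·1)`
  have hent : (∀ i j : Fin 2, (ϖ⁻¹ • (!![-y' - a, -(ϖ ^ (-((2 * k + e : ℕ) : ℤ)) * (y' ^ 2 + t * y' + d)); ϖ ^ (((2 * k + e : ℕ) : ℤ)), y' + t - a] :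
        Matrix (Fin 2) (Fin 2) F)) i j ∈ 𝒪[F]) ↔
      ϖ ^ (-(1 : ℤ)) * (y' + a) ∈ 𝒪[F] ∧ ϖ ^ (-((2 * k + e + 1 : ℕ) : ℤ)) * (y' ^ 2 + t * y' + d) ∈ 𝒪[F] ∧ 1 ≤ 2 * k + e := by
    have q00 : ϖ⁻¹ * (-y' - a) = -(ϖ ^ (-(1 : ℤ)) * (y' + a)) := by rw [_root_.zpow_neg_one]; ring
    have q11 : ϖ⁻¹ * (y' + t - a) = ϖ ^ (-(1 : ℤ)) * (y' + a) + ϖ⁻¹ * f := by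
      rw [_root_.zpow_neg_one, show t = a + a + f by linear_combination htf]; ring
    have q01 : ϖ⁻¹ * -(ϖ ^ (-((2 * k + e : ℕ) : ℤ)) * (y' ^ 2 + t * y' + d)) = -(ϖ ^ (-((2 * k + e + 1 : ℕ) : ℤ)) * (y' ^ 2 + t * y' + d)) := by
      rw [← _root_.zpow_neg_one, neg_mul_eq_mul_neg, ← mul_assoc, ← zpow_add₀ h0]
      push_cast; ring
    have q10 : ϖ⁻¹ * ϖ ^ (((2 * k + e : ℕ) : ℤ)) = ϖ ^ (((2 * k + e : ℕ) : ℤ) - 1) := by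
      rw [← _root_.zpow_neg_one, ← zpow_add₀ h0]; ring_nf
    constructor
    · intro h
      have a00 := h 0 0; have a01 := h 0 1; have a10 := h 1 0
      simp only [Matrix.smul_apply, smul_eq_mul, Matrix.of_apply, Matrix.cons_val', Matrix.cons_val_zero, Matrix.cons_val_one,
        Matrix.cons_val_fin_one, Matrix.empty_val'] at a00 a01 a10
      rw [q00, neg_mem_iff] at a00
      rw [q01, neg_mem_iff] at a01
      rw [q10, zpow_uniformizer_mem_integer_iff hϖ] at a10
      exact ⟨a00, a01, by omega⟩
    · rintro ⟨ha, hb, hc⟩ i j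
      fin_cases i <;> fin_cases j <;>
        simp only [Fin.zero_eta, Fin.mk_one, Matrix.smul_apply, smul_eq_mul, Matrix.of_apply, Matrix.cons_val', Matrix.cons_val_zero,
          Matrix.cons_val_one, Matrix.cons_val_fin_one, Matrix.empty_val']
      · rw [q00, neg_mem_iff]; exact ha
      · rw [q01, neg_mem_iff]; exact hb
      · rw [q10]; exact (zpow_uniformizer_mem_integer_iff hϖ _).2 (by omega)
      · rw [q11]; exact (𝒪[F]).add_mem ha hfϖ
  rw [hent]
  -- the norm entry at the shifted exponent `2k + e + 1 = 2k′ + e′`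
  have hshift : ϖ ^ (-((2 * k + e + 1 : ℕ) : ℤ)) * (y' ^ 2 + t * y' + d) ∈ 𝒪[F] ↔ k + e ≤ j ∧ ϖ ^ (-((k + 1 : ℕ) : ℤ)) * (y' + a) ∈ 𝒪[F] := by
    rcases Nat.le_one_iff_eq_zero_or_eq_one.1 he with rfl | rfl
    · -- `e = 0`: `(k′, e′) = (k, 1)`
      have := affine_norm_condition_iff hϖ hf hj htf hde (k := k) (e := 1) le_rfl y'
      simpa [Nat.add_zero] using this
    · -- `e = 1`: `(k′, e′) = (k + 1, 0)`
      have := affine_norm_condition_iff hϖ hf hj htf hde (k := k + 1) (e := 0) (Nat.zero_le _) y'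
      rw [show 2 * (k + 1) + 0 = 2 * k + 1 + 1 by ring, show k + 1 + 0 = k + 1 from rfl] at this
      exact this
  rw [hshift]
  constructor
  · rintro ⟨-, ⟨hkeN, hk1⟩, h1⟩
    exact ⟨h1, hkeN, hk1⟩
  · rintro ⟨h1, hkeN, hk1⟩
    exact ⟨hpow _ _ hk1 _ (by push_cast; omega), ⟨hkeN, hk1⟩, h1⟩

end Criterion

end Literature.NumberTheory.Automorphic

end
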